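import Summits.RiemannHypothesis.RiemannHypothesis.Theorems.PfPersistenceUnservedPrice
import HarnessLib

/-!
# PF-persistence cell — THE UNIVERSAL TWO-SIDED AUTOCORRELATION CEILING `cos(π/(⌈T/y⌉+1))`

Framing (page 1): mechanism/rigidity campaign; no RH claims.  Every `theorem` below is PROVED (kernel-checked,
RH-free, weight-free; §1–§3 are window-free facts about continuous real functions); nothing asserts a premiss for
`ζ` at any window and no NUMBER for `ζ` is asserted here.

The complete near-lag ladder (`PfPersistenceNearLagLadder`, 186f1e2d346c) types the ONE-SIDED chain bound
`2∫_0^{T-y} f f(·+y) ≤ 2cos(π/(n+3))∫_0^T f²` (`0 < y`, `(n+1)y ≤ T ≤ (n+2)y`); the necessary side of the dial-line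
rigidity schema (`PfPersistenceUnservedPrice`, 529e43ec9032) knows only `|A^±_v(y)| ≤ ‖v‖²` (`τ ≤ 1`, `σ ≤ 1` for a
certificate's correlation floor `τ` (odd) / anti-correlation `σ` (even)).  THIS FILE joins the two, with NO sign,
parity or one-signedness hypothesis anywhere:
* §1 the SIGNED link `2σab ≤ r a² + s b²` (`0 ≤ r`, `rs = 1`, `σ² ≤ 1`) and its integral form;
* §2 the SIGNED chain `2σ∫_0^{T-y} f f(·+y) ≤ 2cos(π/(n+3))∫_0^T f²`, hence THE UNIVERSAL TWO-SIDED CEILING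
  `|∫_0^{T-y} f(t)f(t+y)dt| ≤ cos(π/(⌈T/y⌉₊+1)) · ∫_0^T f²` for EVERY continuous `f` and every lag `0 < y < T`
  (path-graph bound = largest adjacency eigenvalue of `P_M`, [cite: Mieghem2010, §6.4.1 eq. (6.10)]);
* §3 the window forms `|A_v(y)|, |A⁻_v(y)| ≤ cos(π/(⌈L/y⌉₊+1))‖v‖²` for EVERY even / odd coefficient vector and every
  lag `0 < y ≤ L` (both Galerkin autocorrelations of row C6-AUTOCORR-SPLIT); §4 the prime-lag forms at a window
  (`L = 2a`, `y = log p`, `M = ⌈2a/log p⌉₊`);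
* §5 SHARPENED NECESSARY CONDITIONS on certificates: `τ, σ ≤ cos(π/(M+1))` replace `≤ 1`; an odd certificate at
  rung `m` needs `2φN < cos(π/(M+1)) − cos(π/(m+1))`, an even one `2φ(2N+1) < cos(π/(M+1))` — the even jaw,
  price-free in 529e43ec9032, pays this (bounded, `→ 0` as `a → ∞`) price.
REMARK (informal, not typed): the §2 ceiling is the supremum over continuous `f` at EVERY `(T, y)` (bump trains
`Σ_{k<M} sin((k+1)π/(M+1))·β(t − s − ky)` approach it; `chain_tight`, d0076f571175), never attained; the constrained
supremum over ONE-SIGNED odd profiles (RULING A376 (1) P1) is a different question and stays OPEN.  Whether `ζ`'s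
Galerkin data saturate the ceiling at a window is DATA (riders of row C6-AUTOCORR-SPLIT, provenance there),
asserted nowhere in this file.
-/

set_option linter.dupNamespace false
set_option linter.style.longLine false

noncomputable section

namespace Summit.RiemannHypothesis.RiemannHypothesis.Theorems.PfPersistence

open Real intervalIntegral MeasureTheory Matrix BigOperators Finset

/-! ## §1 The signed link -/

/-- PROVED (signed weighted AM–GM): `2σab ≤ r a² + s b²` whenever `0 ≤ r`, `r s = 1` and `σ² ≤ 1`
(`r(ra² + sb² − 2σab) = (ra − σb)² + (1 − σ²)b²`). [folklore] -/
theorem two_mul_sigma_le_weighted {r s σ : ℝ} (hr : 0 ≤ r) (hrs : r * s = 1) (hσ : σ ^ 2 ≤ 1) (a b : ℝ) :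
    2 * σ * a * b ≤ r * a ^ 2 + s * b ^ 2 := by
  have hr0 : 0 < r := by
    rcases lt_or_eq_of_le hr with h | h
    · exact h
    · exfalso; rw [← h, zero_mul] at hrs; exact zero_ne_one hrs
  have key : r * (r * a ^ 2 + s * b ^ 2 - 2 * σ * a * b) = (r * a - σ * b) ^ 2 + (1 - σ ^ 2) * b ^ 2 := by
    have e : r * (r * a ^ 2 + s * b ^ 2 - 2 * σ * a * b)
        = (r * a - σ * b) ^ 2 + (1 - σ ^ 2) * b ^ 2 + (r * s - 1) * b ^ 2 := by ring
    rw [e, hrs]; ring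
  have h2 : 0 ≤ r * (r * a ^ 2 + s * b ^ 2 - 2 * σ * a * b) := by
    rw [key]; exact add_nonneg (sq_nonneg _) (mul_nonneg (by linarith) (sq_nonneg b))
  have h3 : 0 ≤ r * a ^ 2 + s * b ^ 2 - 2 * σ * a * b := by nlinarith [h2, hr0]
  linarith

/-- PROVED (the signed chain step): `2σ∫_a^b f(t)f(t+y)dt ≤ r∫_a^b f² + s∫_{a+y}^{b+y} f²` for continuous `f`,
`a ≤ b`, `0 ≤ r`, `r s = 1`, `σ² ≤ 1`. [folklore] -/
theorem two_mul_sigma_integral_mul_shift_le {f : ℝ → ℝ} (hf : Continuous f) {a b : ℝ} (hab : a ≤ b) (y : ℝ)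
    {r s σ : ℝ} (hr : 0 ≤ r) (hrs : r * s = 1) (hσ : σ ^ 2 ≤ 1) :
    2 * σ * ∫ t in a..b, f t * f (t + y)
      ≤ r * (∫ t in a..b, f t ^ 2) + s * (∫ t in (a + y)..(b + y), f t ^ 2) := by
  have h1 : ∫ t in a..b, 2 * σ * (f t * f (t + y)) ≤ ∫ t in a..b, (r * f t ^ 2 + s * f (t + y) ^ 2) := by
    refine intervalIntegral.integral_mono_on hab ?_ ?_ fun t _ => ?_
    · exact Continuous.intervalIntegrable (by fun_prop) _ _
    · exact Continuous.intervalIntegrable (by fun_prop) _ _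
    · have := two_mul_sigma_le_weighted hr hrs hσ (f t) (f (t + y)); linarith
  have h2 : ∫ t in a..b, (r * f t ^ 2 + s * f (t + y) ^ 2)
      = r * (∫ t in a..b, f t ^ 2) + s * (∫ t in a..b, f (t + y) ^ 2) := by
    rw [intervalIntegral.integral_add (Continuous.intervalIntegrable (by fun_prop) _ _)
      (Continuous.intervalIntegrable (by fun_prop) _ _), intervalIntegral.integral_const_mul,
      intervalIntegral.integral_const_mul]
  have h3 : ∫ t in a..b, f (t + y) ^ 2 = ∫ t in (a + y)..(b + y), f t ^ 2 :=
    intervalIntegral.integral_comp_add_right (fun t => f t ^ 2) y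
  rw [intervalIntegral.integral_const_mul] at h1
  rw [← h3, ← h2]
  exact h1

/-! ## §2 The signed chain and the universal two-sided ceiling -/

/-- **PROVED — THE SIGNED CONTINUOUS CHAIN BOUND:** for continuous `f`, `0 < y`, `(n+1)y ≤ T ≤ (n+2)y` and any
`σ` with `σ² ≤ 1`, `2σ∫_0^{T-y} f(t)f(t+y)dt ≤ 2cos(π/(n+3)) · ∫_0^T f(t)²dt` (the cells and chain weights of
`two_mul_integral_mul_shift_le_cos`, the signed link on each cell). [cite: Mieghem2010, §6.4.1 eq. (6.10)] -/
theorem two_mul_sigma_integral_mul_shift_le_cos {f : ℝ → ℝ} (hf : Continuous f) {y T : ℝ} (hy : 0 < y) (n : ℕ)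
    (hT1 : ((n:ℝ) + 1) * y ≤ T) (hT2 : T ≤ ((n:ℝ) + 2) * y) {σ : ℝ} (hσ : σ ^ 2 ≤ 1) :
    2 * σ * ∫ t in (0:ℝ)..(T - y), f t * f (t + y)
      ≤ 2 * Real.cos (π / ((n:ℝ) + 3)) * ∫ t in (0:ℝ)..T, f t ^ 2 := by
  set c : ℕ → ℝ := fun k => min ((k:ℝ) * y) T with hc
  set c' : ℕ → ℝ := fun k => min ((k:ℝ) * y) (T - y) with hc'
  have hc0 : c 0 = 0 := by simp [hc]; nlinarith
  have hcN : c (n + 2) = T := by simp [hc]; linarith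
  have hc'0 : c' 0 = 0 := by simp [hc']; nlinarith
  have hc'N : c' (n + 1) = T - y := by simp [hc']; nlinarith
  have hcell : ∀ k, k < n + 1 → c k = (k:ℝ) * y ∧ c' k = (k:ℝ) * y := by
    intro k hk
    have hk' : (k:ℝ) ≤ n := by exact_mod_cast Nat.lt_succ_iff.mp hk
    have h1 : (k:ℝ) * y ≤ T - y := by nlinarith
    exact ⟨min_eq_left (by linarith), min_eq_left h1⟩
  have hshift : ∀ k, c' k + y = c (k + 1) := by
    intro k
    show min ((k:ℝ) * y) (T - y) + y = min (((k + 1 : ℕ):ℝ) * y) T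
    rw [← min_add_add_right]
    push_cast
    congr 1 <;> ring
  have hmono' : ∀ k, c' k ≤ c' (k + 1) := by
    intro k; simp only [hc']; push_cast
    exact min_le_min_right _ (by nlinarith)
  have hle : ∀ k, c' k ≤ c k := fun k => min_le_min_left _ (by linarith)
  have hB : ∑ k ∈ Finset.range (n + 1), ∫ t in (c' k)..(c' (k + 1)), f t * f (t + y)
      = ∫ t in (0:ℝ)..(T - y), f t * f (t + y) := by
    rw [intervalIntegral.sum_integral_adjacent_intervals fun k _ =>
      (Continuous.intervalIntegrable (by fun_prop) _ _), hc'0, hc'N]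
  have hF : ∑ k ∈ Finset.range (n + 2), ∫ t in (c k)..(c (k + 1)), f t ^ 2 = ∫ t in (0:ℝ)..T, f t ^ 2 := by
    rw [intervalIntegral.sum_integral_adjacent_intervals fun k _ =>
      (Continuous.intervalIntegrable (by fun_prop) _ _), hc0, hcN]
  have hlink : ∀ k ∈ Finset.range (n + 1),
      2 * σ * ∫ t in (c' k)..(c' (k + 1)), f t * f (t + y)
        ≤ Real.sin (((k:ℝ) + 1 + 1) * (π / ((n:ℝ) + 3))) / Real.sin (((k:ℝ) + 1) * (π / ((n:ℝ) + 3)))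
            * (∫ t in (c k)..(c (k + 1)), f t ^ 2)
          + Real.sin (((k:ℝ) + 1) * (π / ((n:ℝ) + 3))) / Real.sin (((k:ℝ) + 1 + 1) * (π / ((n:ℝ) + 3)))
            * (∫ t in (c (k + 1))..(c (k + 1 + 1)), f t ^ 2) := by
    intro k hk
    rw [Finset.mem_range] at hk
    have hρ0 : 0 < Real.sin (((k:ℝ) + 1) * (π / ((n:ℝ) + 3))) := sin_chain_pos (by omega)
    have hρ1 : 0 < Real.sin (((k:ℝ) + 1 + 1) * (π / ((n:ℝ) + 3))) := by
      have := sin_chain_pos (n := n) (k := k + 1) (by omega); push_cast at this; exact this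
    have hr : 0 ≤ Real.sin (((k:ℝ) + 1 + 1) * (π / ((n:ℝ) + 3))) / Real.sin (((k:ℝ) + 1) * (π / ((n:ℝ) + 3))) :=
      div_nonneg hρ1.le hρ0.le
    have hrs : Real.sin (((k:ℝ) + 1 + 1) * (π / ((n:ℝ) + 3))) / Real.sin (((k:ℝ) + 1) * (π / ((n:ℝ) + 3)))
        * (Real.sin (((k:ℝ) + 1) * (π / ((n:ℝ) + 3))) / Real.sin (((k:ℝ) + 1 + 1) * (π / ((n:ℝ) + 3)))) = 1 := by
      rw [div_mul_div_comm, div_eq_one_iff_eq (mul_ne_zero (ne_of_gt hρ0) (ne_of_gt hρ1))]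
      ring
    have p := two_mul_sigma_integral_mul_shift_le hf (hmono' k) y hr hrs hσ
    rw [hshift k, hshift (k + 1)] at p
    have hsq : ∫ t in (c' k)..(c' (k + 1)), f t ^ 2 ≤ ∫ t in (c k)..(c (k + 1)), f t ^ 2 := by
      have e : c k = c' k := by rw [(hcell k hk).1, (hcell k hk).2]
      rw [e]
      exact integral_sq_mono_interval hf le_rfl (hmono' k) (hle (k + 1))
    have := mul_le_mul_of_nonneg_left hsq hr
    linarith
  have hsum := Finset.sum_le_sum hlink
  rw [← Finset.mul_sum, hB] at hsum
  have hchain := chain_sum_eq n (fun k => ∫ t in (c k)..(c (k + 1)), f t ^ 2)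
  beta_reduce at hchain
  rw [hF] at hchain
  linarith [hsum, hchain]

/-- **PROVED — THE TWO-SIDED CONTINUOUS CHAIN BOUND** (band form): for continuous `f`, `0 < y` and
`(n+1)y ≤ T ≤ (n+2)y`, `|∫_0^{T-y} f(t)f(t+y)dt| ≤ cos(π/(n+3)) · ∫_0^T f(t)²dt` (`σ = ±1` in the signed chain).
[cite: Mieghem2010, §6.4.1 eq. (6.10)] -/
theorem abs_integral_mul_shift_le_cos {f : ℝ → ℝ} (hf : Continuous f) {y T : ℝ} (hy : 0 < y) (n : ℕ)
    (hT1 : ((n:ℝ) + 1) * y ≤ T) (hT2 : T ≤ ((n:ℝ) + 2) * y) :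
    |∫ t in (0:ℝ)..(T - y), f t * f (t + y)| ≤ Real.cos (π / ((n:ℝ) + 3)) * ∫ t in (0:ℝ)..T, f t ^ 2 := by
  have h1 := two_mul_sigma_integral_mul_shift_le_cos hf hy n hT1 hT2 (σ := 1) (by norm_num)
  have h2 := two_mul_sigma_integral_mul_shift_le_cos hf hy n hT1 hT2 (σ := -1) (by norm_num)
  rw [abs_le]; constructor <;> linarith

/-- **PROVED — THE UNIVERSAL TWO-SIDED AUTOCORRELATION CEILING** (lag-only form): for EVERY continuous `f` and
every lag `0 < y < T`, `|∫_0^{T-y} f(t)f(t+y)dt| ≤ cos(π/(⌈T/y⌉₊+1)) · ∫_0^T f(t)²dt` (the band the lag sits in is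
`n = ⌈T/y⌉₊ − 2`).  No sign, parity or Galerkin hypothesis. [cite: Mieghem2010, §6.4.1 eq. (6.10)] -/
theorem abs_integral_mul_shift_le_cos_ceil {f : ℝ → ℝ} (hf : Continuous f) {y T : ℝ} (hy : 0 < y) (hyT : y < T) :
    |∫ t in (0:ℝ)..(T - y), f t * f (t + y)|
      ≤ Real.cos (π / (((⌈T / y⌉₊ : ℕ) : ℝ) + 1)) * ∫ t in (0:ℝ)..T, f t ^ 2 := by
  set x : ℝ := T / y with hx
  have hxy : x * y = T := by rw [hx]; exact div_mul_cancel₀ T (ne_of_gt hy)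
  have hx1 : 1 < x := by rw [hx, lt_div_iff₀ hy]; linarith
  set M : ℕ := ⌈x⌉₊ with hM
  have hxM : x ≤ (M:ℝ) := Nat.le_ceil x
  have hMx : (M:ℝ) < x + 1 := Nat.ceil_lt_add_one (by linarith)
  have hM2 : 2 ≤ M := by
    have : 1 < M := by exact_mod_cast (lt_of_lt_of_le hx1 hxM : (1:ℝ) < (M:ℝ))
    omega
  obtain ⟨n, hn⟩ : ∃ n : ℕ, M = n + 2 := ⟨M - 2, by omega⟩
  have hn' : ((n:ℝ) + 2) = (M:ℝ) := by rw [hn]; push_cast; ring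
  have hT1 : ((n:ℝ) + 1) * y ≤ T := by
    have h1 : (M:ℝ) * y < (x + 1) * y := mul_lt_mul_of_pos_right hMx hy
    have e : (n:ℝ) + 1 = (M:ℝ) - 1 := by linarith [hn']
    rw [e]; linarith [h1, hxy]
  have hT2 : T ≤ ((n:ℝ) + 2) * y := by
    have h1 : x * y ≤ (M:ℝ) * y := mul_le_mul_of_nonneg_right hxM hy.le
    rw [hn']; linarith [h1, hxy]
  have h := abs_integral_mul_shift_le_cos hf hy n hT1 hT2
  have e3 : (n:ℝ) + 3 = (M:ℝ) + 1 := by linarith [hn']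
  rwa [e3] at h

/-! ## §3 The window forms: every even and every odd Galerkin autocorrelation -/

/-- PROVED (translation `x = t − L/2`): the windowed shifted correlation is a correlation on `[0, L − y]`. [folklore] -/
theorem integral_window_shift_eq (f : ℝ → ℝ) (L y : ℝ) :
    ∫ x in (-(L / 2))..(L / 2 - y), f x * f (x + y)
      = ∫ t in (0:ℝ)..(L - y), f (t - L / 2) * f (t + y - L / 2) := by
  have h := intervalIntegral.integral_comp_sub_right (fun x => f x * f (x + y)) (L / 2) (a := (0:ℝ)) (b := L - y)
  rw [zero_sub, show L - y - L / 2 = L / 2 - y by ring] at h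
  rw [← h]
  refine intervalIntegral.integral_congr fun t _ => ?_
  show f (t - L / 2) * f (t - L / 2 + y) = f (t - L / 2) * f (t + y - L / 2)
  rw [show t - L / 2 + y = t + y - L / 2 by ring]

/-- PROVED (translation `x = t − L/2`): the window energy is the energy on `[0, L]`. [folklore] -/
theorem integral_window_sq_eq (f : ℝ → ℝ) (L : ℝ) :
    ∫ x in (-(L / 2))..(L / 2), f x ^ 2 = ∫ t in (0:ℝ)..L, f (t - L / 2) ^ 2 := by
  have h := intervalIntegral.integral_comp_sub_right (fun x => f x ^ 2) (L / 2) (a := (0:ℝ)) (b := L)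
  rw [zero_sub, show L - L / 2 = L / 2 by ring] at h
  exact h.symm

/-- **PROVED — THE TWO-SIDED CEILING ON A WINDOW** (band form): for continuous `f`, `0 < y`, `(n+1)y ≤ L ≤ (n+2)y`,
`|∫_{-L/2}^{L/2-y} f(x)f(x+y)dx| ≤ cos(π/(n+3)) · ∫_{-L/2}^{L/2} f²`. [cite: Mieghem2010, §6.4.1 eq. (6.10)] -/
theorem abs_integral_window_shift_le_cos {f : ℝ → ℝ} (hf : Continuous f) {L y : ℝ} (hy : 0 < y) (n : ℕ)
    (hL1 : ((n:ℝ) + 1) * y ≤ L) (hL2 : L ≤ ((n:ℝ) + 2) * y) :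
    |∫ x in (-(L / 2))..(L / 2 - y), f x * f (x + y)|
      ≤ Real.cos (π / ((n:ℝ) + 3)) * ∫ x in (-(L / 2))..(L / 2), f x ^ 2 := by
  rw [integral_window_shift_eq, integral_window_sq_eq]
  exact abs_integral_mul_shift_le_cos (f := fun t => f (t - L / 2)) (by fun_prop) hy n hL1 hL2

/-- **PROVED — THE TWO-SIDED CEILING ON A WINDOW** (lag-only form, `0 < y < L`):
`|∫_{-L/2}^{L/2-y} f(x)f(x+y)dx| ≤ cos(π/(⌈L/y⌉₊+1)) · ∫_{-L/2}^{L/2} f²`. [cite: Mieghem2010, §6.4.1 eq. (6.10)] -/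
theorem abs_integral_window_shift_le_cos_ceil {f : ℝ → ℝ} (hf : Continuous f) {L y : ℝ} (hy : 0 < y)
    (hyL : y < L) :
    |∫ x in (-(L / 2))..(L / 2 - y), f x * f (x + y)|
      ≤ Real.cos (π / (((⌈L / y⌉₊ : ℕ) : ℝ) + 1)) * ∫ x in (-(L / 2))..(L / 2), f x ^ 2 := by
  rw [integral_window_shift_eq, integral_window_sq_eq]
  exact abs_integral_mul_shift_le_cos_ceil (f := fun t => f (t - L / 2)) (by fun_prop) hy hyL

/-- **PROVED — EVEN GALERKIN AUTOCORRELATION CEILING** (every `v`, every lag `0 < y ≤ L`):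
`|A_v(y)| ≤ cos(π/(⌈L/y⌉₊+1))‖v‖²` (at `y = L` both sides vanish). [cite: Mieghem2010, §6.4.1 eq. (6.10)] -/
theorem abs_autocorr_le_cos_ceil {L : ℝ} (hL : 0 < L) {N : ℕ} (v : Fin (N + 1) → ℝ) {y : ℝ} (hy : 0 < y)
    (hyL : y ≤ L) :
    |autocorr L v y| ≤ Real.cos (π / (((⌈L / y⌉₊ : ℕ) : ℝ) + 1)) * (v ⬝ᵥ v) := by
  rcases lt_or_eq_of_le hyL with hlt | heq
  · have h := abs_integral_window_shift_le_cos_ceil (CentralMassFloor.continuous_profile L v) hy hlt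
    rw [CentralMassFloor.integral_profile_sq hL v] at h
    exact h
  · have h1 : autocorr L v L = 0 := by
      unfold autocorr
      rw [show L / 2 - L = -(L / 2) by ring, intervalIntegral.integral_same]
    have h2 : (⌈L / L⌉₊ : ℕ) = 1 := by rw [div_self (ne_of_gt hL), Nat.ceil_one]
    rw [heq, h1, abs_zero]
    exact mul_nonneg (cos_rung_nonneg (by rw [h2])) (dotProduct_self_nonneg_real v)

/-- **PROVED — ODD GALERKIN AUTOCORRELATION CEILING** (every `v`, every lag `0 < y ≤ L`):
`|A⁻_v(y)| ≤ cos(π/(⌈L/y⌉₊+1))‖v‖²`. [cite: Mieghem2010, §6.4.1 eq. (6.10)] -/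
theorem abs_oddAutocorr_le_cos_ceil {L : ℝ} (hL : 0 < L) {N : ℕ} (v : Fin N → ℝ) {y : ℝ} (hy : 0 < y)
    (hyL : y ≤ L) :
    |oddAutocorr L v y| ≤ Real.cos (π / (((⌈L / y⌉₊ : ℕ) : ℝ) + 1)) * (v ⬝ᵥ v) := by
  rcases lt_or_eq_of_le hyL with hlt | heq
  · have h := abs_integral_window_shift_le_cos_ceil (continuous_profileOdd L v) hy hlt
    rw [integral_profileOdd_sq hL v] at h
    exact h
  · have h1 : oddAutocorr L v L = 0 := by
      unfold oddAutocorr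
      rw [show L / 2 - L = -(L / 2) by ring, intervalIntegral.integral_same]
    have h2 : (⌈L / L⌉₊ : ℕ) = 1 := by rw [div_self (ne_of_gt hL), Nat.ceil_one]
    rw [heq, h1, abs_zero]
    exact mul_nonneg (cos_rung_nonneg (by rw [h2])) (dotProduct_self_nonneg_real v)

/-! ## §4 The prime-lag forms at a window (`L = 2a`, `y = log p`, `M = ⌈2a/log p⌉₊`) -/

/-- **PROVED — at a window, for every prime power `p` it reaches with `0 < log p` and EVERY even `v`:**
`|A_v(log p)| ≤ cos(π/(⌈2a/log p⌉₊+1))‖v‖²`. [cite: Mieghem2010, §6.4.1 eq. (6.10)] -/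
theorem abs_autocorr_log_le_cos {win : Window} {p : ℕ} (hp : p ∈ primeRange (2 * win.a))
    (hlog : 0 < Real.log p) (v : Fin (win.N + 1) → ℝ) :
    |autocorr (2 * win.a) v (Real.log p)|
      ≤ Real.cos (π / (((⌈2 * win.a / Real.log p⌉₊ : ℕ) : ℝ) + 1)) * (v ⬝ᵥ v) := by
  have hL : 0 < 2 * win.a := by linarith [win.ha]
  exact abs_autocorr_le_cos_ceil hL v hlog (log_le_of_mem_primeRange hL.le hp)

/-- **PROVED — at a window, for every prime power `p` it reaches with `0 < log p` and EVERY odd `v`:**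
`|A⁻_v(log p)| ≤ cos(π/(⌈2a/log p⌉₊+1))‖v‖²`. [cite: Mieghem2010, §6.4.1 eq. (6.10)] -/
theorem abs_oddAutocorr_log_le_cos {win : Window} {p : ℕ} (hp : p ∈ primeRange (2 * win.a))
    (hlog : 0 < Real.log p) (v : Fin win.N → ℝ) :
    |oddAutocorr (2 * win.a) v (Real.log p)|
      ≤ Real.cos (π / (((⌈2 * win.a / Real.log p⌉₊ : ℕ) : ℝ) + 1)) * (v ⬝ᵥ v) := by
  have hL : 0 < 2 * win.a := by linarith [win.ha]
  exact abs_oddAutocorr_le_cos_ceil hL v hlog (log_le_of_mem_primeRange hL.le hp)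

/-! ## §5 Sharpened necessary conditions on certificates -/

/-- **PROVED — a correlation floor is at most the ceiling:** `τ‖v‖² ≤ A⁻_v(y)`, `v ≠ 0`, `0 < y ≤ L` ⇒
`τ ≤ cos(π/(⌈L/y⌉₊+1))` (sharpens `tau_le_one_of_floor`). [folklore] -/
theorem tau_le_cos_of_floor {L : ℝ} (hL : 0 < L) {N : ℕ} {v : Fin N → ℝ} (hv : v ≠ 0) {y : ℝ} (hy : 0 < y)
    (hyL : y ≤ L) {τ : ℝ} (hτ : τ * (v ⬝ᵥ v) ≤ oddAutocorr L v y) :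
    τ ≤ Real.cos (π / (((⌈L / y⌉₊ : ℕ) : ℝ) + 1)) := by
  have hvv : 0 < v ⬝ᵥ v :=
    lt_of_le_of_ne (dotProduct_self_nonneg_real v) fun h => hv (dotProduct_self_eq_zero.1 h.symm)
  have h := (abs_le.1 (abs_oddAutocorr_le_cos_ceil hL v hy hyL)).2
  nlinarith

/-- **PROVED — an anti-correlation is at most the ceiling:** `A_v(y) ≤ −σ‖v‖²`, `v ≠ 0`, `0 < y ≤ L` ⇒
`σ ≤ cos(π/(⌈L/y⌉₊+1))` (sharpens `sigma_le_one_of_anticorr`). [folklore] -/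
theorem sigma_le_cos_of_anticorr {L : ℝ} (hL : 0 < L) {N : ℕ} {v : Fin (N + 1) → ℝ} (hv : v ≠ 0) {y : ℝ}
    (hy : 0 < y) (hyL : y ≤ L) {σ : ℝ} (hσ : autocorr L v y ≤ -σ * (v ⬝ᵥ v)) :
    σ ≤ Real.cos (π / (((⌈L / y⌉₊ : ℕ) : ℝ) + 1)) := by
  have hvv : 0 < v ⬝ᵥ v :=
    lt_of_le_of_ne (dotProduct_self_nonneg_real v) fun h => hv (dotProduct_self_eq_zero.1 h.symm)
  have h := (abs_le.1 (abs_autocorr_le_cos_ceil hL v hy hyL)).1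
  nlinarith

/-- **PROVED — at a window:** an odd correlation floor at the prime power `p` (`0 < log p`) obeys
`τ ≤ cos(π/(⌈2a/log p⌉₊+1))`. [folklore] -/
theorem tau_le_cos_window {win : Window} {p : ℕ} (hp : p ∈ primeRange (2 * win.a)) (hlog : 0 < Real.log p)
    {v : Fin win.N → ℝ} (hv : v ≠ 0) {τ : ℝ} (hτ : τ * (v ⬝ᵥ v) ≤ oddAutocorr (2 * win.a) v (Real.log p)) :
    τ ≤ Real.cos (π / (((⌈2 * win.a / Real.log p⌉₊ : ℕ) : ℝ) + 1)) := by
  have hL : 0 < 2 * win.a := by linarith [win.ha]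
  exact tau_le_cos_of_floor hL hv hlog (log_le_of_mem_primeRange hL.le hp) hτ

/-- **PROVED — at a window:** an even anti-correlation at the prime power `p` (`0 < log p`) obeys
`σ ≤ cos(π/(⌈2a/log p⌉₊+1))`. [folklore] -/
theorem sigma_le_cos_window {win : Window} {p : ℕ} (hp : p ∈ primeRange (2 * win.a)) (hlog : 0 < Real.log p)
    {v : Fin (win.N + 1) → ℝ} (hv : v ≠ 0) {σ : ℝ} (hσ : autocorr (2 * win.a) v (Real.log p) ≤ -σ * (v ⬝ᵥ v)) :
    σ ≤ Real.cos (π / (((⌈2 * win.a / Real.log p⌉₊ : ℕ) : ℝ) + 1)) := by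
  have hL : 0 < 2 * win.a := by linarith [win.ha]
  exact sigma_le_cos_of_anticorr hL hv hlog (log_le_of_mem_primeRange hL.le hp) hσ

/-- **PROVED — THE ODD CERTIFICATE UNDER THE CEILING** (any rung `m` in the certificate, `0 ≤ w p`, `0 < δ`,
`0 < log p`): `ℓ' − ε₁⁻ < 2δ·w_p·(τ − cos(π/(m+1)) − 2φN)` forces
`ℓ' − ε₁⁻ < 2δ·w_p·(cos(π/(⌈2a/log p⌉₊+1)) − cos(π/(m+1)) − 2φN)`. [folklore] -/
theorem oddCertificate_gap_lt_sharp {win : Window} {p : ℕ} (hp : p ∈ primeRange (2 * win.a))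
    (hlog : 0 < Real.log p) {w : Weights} (hw : 0 ≤ w p) {φ : ℝ} {m : ℕ} {δ : ℝ} (hδ : 0 < δ)
    {v : Fin win.N → ℝ} (hv : v ≠ 0) {ℓ τ : ℝ} (hτ : τ * (v ⬝ᵥ v) ≤ oddAutocorr (2 * win.a) v (Real.log p))
    (hcert : ℓ - bottomRayleigh (oddBlock w win)
      < 2 * δ * w p * (τ - Real.cos (π / ((m:ℝ) + 1)) - 2 * φ * win.N)) :
    ℓ - bottomRayleigh (oddBlock w win)
      < 2 * δ * w p * (Real.cos (π / (((⌈2 * win.a / Real.log p⌉₊ : ℕ) : ℝ) + 1))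
          - Real.cos (π / ((m:ℝ) + 1)) - 2 * φ * win.N) := by
  have hτC := tau_le_cos_window hp hlog hv hτ
  have hdw : 0 ≤ 2 * δ * w p := by positivity
  calc ℓ - bottomRayleigh (oddBlock w win) < _ := hcert
    _ ≤ _ := mul_le_mul_of_nonneg_left (by linarith) hdw

/-- **PROVED — THE SHARPENED FLOOR PRICE (odd):** an odd certificate at rung `m` (`0 < w p`, `0 < δ`, a level
bound `ℓ'`, `0 < log p`) exists only if `2φN < cos(π/(⌈2a/log p⌉₊+1)) − cos(π/(m+1))` (sharpens
`floor_lt_of_oddCertificate`, whose right side is `1 − cos(π/(m+1))`). [folklore] -/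
theorem floor_lt_cos_sub_cos_of_oddCertificate {win : Window} {p : ℕ} (hp : p ∈ primeRange (2 * win.a))
    (hlog : 0 < Real.log p) {w : Weights} (hw : 0 < w p) {φ : ℝ} {m : ℕ} {δ : ℝ} (hδ : 0 < δ)
    {v : Fin win.N → ℝ} (hv : v ≠ 0) {ℓ τ : ℝ} (hℓ : v ⬝ᵥ (oddBlock w win *ᵥ v) ≤ ℓ * (v ⬝ᵥ v))
    (hτ : τ * (v ⬝ᵥ v) ≤ oddAutocorr (2 * win.a) v (Real.log p))
    (hcert : ℓ - bottomRayleigh (oddBlock w win)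
      < 2 * δ * w p * (τ - Real.cos (π / ((m:ℝ) + 1)) - 2 * φ * win.N)) :
    2 * φ * win.N < Real.cos (π / (((⌈2 * win.a / Real.log p⌉₊ : ℕ) : ℝ) + 1)) - Real.cos (π / ((m:ℝ) + 1)) := by
  have hτC := tau_le_cos_window hp hlog hv hτ
  have hge : 0 ≤ ℓ - bottomRayleigh (oddBlock w win) := by
    have hvv : 0 < v ⬝ᵥ v :=
      lt_of_le_of_ne (dotProduct_self_nonneg_real v) fun h => hv (dotProduct_self_eq_zero.1 h.symm)
    have h := bottomRayleigh_mul_le_form (oddBlock w win) v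
    nlinarith
  have hpos : 0 < τ - Real.cos (π / ((m:ℝ) + 1)) - 2 * φ * win.N := by
    by_contra h; push Not at h
    have : 2 * δ * w p * (τ - Real.cos (π / ((m:ℝ) + 1)) - 2 * φ * win.N) ≤ 0 :=
      mul_nonpos_iff.2 (Or.inl ⟨by positivity, h⟩)
    linarith
  linarith

/-- **PROVED — THE EVEN CERTIFICATE UNDER THE CEILING** (`0 ≤ w p`, `0 < δ`, `0 < log p`):
`ℓ − ε₁⁺ < 2δ·w_p·(σ − 2φ(2N+1))` forces `ℓ − ε₁⁺ < 2δ·w_p·(cos(π/(⌈2a/log p⌉₊+1)) − 2φ(2N+1))` (sharpens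
`evenCertificate_gap_lt`, whose right side is `2δ·w_p`). [folklore] -/
theorem evenCertificate_gap_lt_sharp {win : Window} {p : ℕ} (hp : p ∈ primeRange (2 * win.a))
    (hlog : 0 < Real.log p) {w : Weights} (hw : 0 ≤ w p) {φ : ℝ} {δ : ℝ} (hδ : 0 < δ)
    {v : Fin (win.N + 1) → ℝ} (hv : v ≠ 0) {ℓ σ : ℝ} (hσ : autocorr (2 * win.a) v (Real.log p) ≤ -σ * (v ⬝ᵥ v))
    (hcert : ℓ - bottomRayleigh (evenBlock w win) < 2 * δ * w p * (σ - 2 * φ * (2 * win.N + 1))) :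
    ℓ - bottomRayleigh (evenBlock w win)
      < 2 * δ * w p * (Real.cos (π / (((⌈2 * win.a / Real.log p⌉₊ : ℕ) : ℝ) + 1)) - 2 * φ * (2 * win.N + 1)) := by
  have hσC := sigma_le_cos_window hp hlog hv hσ
  have hdw : 0 ≤ 2 * δ * w p := by positivity
  calc ℓ - bottomRayleigh (evenBlock w win) < _ := hcert
    _ ≤ _ := mul_le_mul_of_nonneg_left (by linarith) hdw

/-- **PROVED — THE EVEN FLOOR PRICE:** an even certificate (`0 < w p`, `0 < δ`, a level bound `ℓ`, `0 < log p`)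
exists only if `2φ(2N+1) < cos(π/(⌈2a/log p⌉₊+1))` — the even jaw, price-free in `evenCertificate_gap_lt`, pays
this bounded price (it does NOT grow down the ladder: the ceiling tends to `1` as `a → ∞`). [folklore] -/
theorem floor_lt_cos_of_evenCertificate {win : Window} {p : ℕ} (hp : p ∈ primeRange (2 * win.a))
    (hlog : 0 < Real.log p) {w : Weights} (hw : 0 < w p) {φ : ℝ} {δ : ℝ} (hδ : 0 < δ)
    {v : Fin (win.N + 1) → ℝ} (hv : v ≠ 0) {ℓ σ : ℝ} (hℓ : v ⬝ᵥ (evenBlock w win *ᵥ v) ≤ ℓ * (v ⬝ᵥ v))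
    (hσ : autocorr (2 * win.a) v (Real.log p) ≤ -σ * (v ⬝ᵥ v))
    (hcert : ℓ - bottomRayleigh (evenBlock w win) < 2 * δ * w p * (σ - 2 * φ * (2 * win.N + 1))) :
    2 * φ * (2 * win.N + 1) < Real.cos (π / (((⌈2 * win.a / Real.log p⌉₊ : ℕ) : ℝ) + 1)) := by
  have hσC := sigma_le_cos_window hp hlog hv hσ
  have hge : 0 ≤ ℓ - bottomRayleigh (evenBlock w win) := by
    have hvv : 0 < v ⬝ᵥ v :=
      lt_of_le_of_ne (dotProduct_self_nonneg_real v) fun h => hv (dotProduct_self_eq_zero.1 h.symm)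
    have h := bottomRayleigh_mul_le_form (evenBlock w win) v
    nlinarith
  have hpos : 0 < σ - 2 * φ * (2 * win.N + 1) := by
    by_contra h; push Not at h
    have : 2 * δ * w p * (σ - 2 * φ * (2 * win.N + 1)) ≤ 0 :=
      mul_nonpos_iff.2 (Or.inl ⟨by positivity, h⟩)
    linarith
  linarith

end Summit.RiemannHypothesis.RiemannHypothesis.Theorems.PfPersistence

end
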